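import Mathlib
import Literature.Computability.Complexity.CNF
import Literature.Computability.Complexity.CoinCounting
import Literature.Computability.Complexity.ApproximateCounting
import Literature.Computability.Complexity.CHSums
import Literature.Computability.Complexity.UniformDerandomizationSelectByTesting
import Literature.Computability.Complexity.CountingHierarchyProofs
import Literature.Computability.Complexity.BPExpOperator
import Literature.Computability.Complexity.BPPErrorReduction
import Summits.PneNP.PneNP.Theses.WitnessForging
import Summits.PneNP.PneNP.Theorems.WitnessForgingSatBridgeDefs

/-!
# Route WitnessForging — support item `SatBridge` (stmt-PneNP-2432), part 4a: the biased coin and one round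

The law of one round of the JVV sampler (`stepJVV`, `WitnessForgingSatBridgeDefs.lean`) with an
ABSTRACT estimator `est`: the biased coin `choiceBit` hits the wanted side with probability
`≥ N_b/(N₀+N₁) - 2^{-L}` (`choice_prob_ge`, exact count of the numerals below the least threshold,
`cnt_val_lt`), accurate estimates give the bias `(c_b/(c₀+c₁))/(1+1/k)²` (`bias_of_accurate`), and
two fibrewise lower bounds over the independent coin pieces `u₀, u₁, v` give the round bound
`step_prob_ge` (`le_uniformProb_add_of_fibre`). Counting tool: `cnt_preimage_eq_sum`.
-/

set_option linter.dupNamespace false -- `Summit.PneNP.PneNP.…`: summit = sub-problem (D-0017)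

namespace Summit.PneNP.PneNP.Theorems.SatBridgeJVV

open Literature.Computability.Complexity
open _root_.Computability Finset

/-! ### Counting tools -/

/-- **Fibre counting of a function's values**: the strings mapped into a finite set `S` are counted
value by value. [folklore] -/
theorem cnt_preimage_eq_sum {α : Type} [DecidableEq α] (m : ℕ) (f : List Bool → α) (S : Finset α) :
    cnt m {ω | f ω ∈ S} = ∑ y ∈ S, cnt m {ω | f ω = y} := by
  classical
  induction S using Finset.induction_on with
  | empty => simp [cnt]
  | insert a S ha ih =>
    rw [Finset.sum_insert ha, ← ih]
    have hset : {ω : List Bool | f ω ∈ insert a S} = {ω | f ω = a} ∪ {ω | f ω ∈ S} := by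
      ext ω; simp
    rw [hset, cnt_union_of_disjoint]
    exact Set.disjoint_left.2 fun ω (h1 : f ω = a) (h2 : f ω ∈ S) => ha (h1 ▸ h2)

/-! ### The biased coin -/

/-- **The least threshold**: for `S = N₀ + N₁ > 0` there is a least `θ` with `N₁ · 2^L ≤ θ · S`, it is
at most `2^L`, and `t · S < N₁ · 2^L ↔ t < θ`. [folklore] -/
theorem exists_threshold (N₀ N₁ L : ℕ) (hS : 0 < N₀ + N₁) :
    ∃ θ : ℕ, θ ≤ 2 ^ L ∧ N₁ * 2 ^ L ≤ θ * (N₀ + N₁) ∧ θ * (N₀ + N₁) < N₁ * 2 ^ L + (N₀ + N₁) ∧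
      ∀ t : ℕ, t * (N₀ + N₁) < N₁ * 2 ^ L ↔ t < θ := by
  classical
  have h2L : N₁ * 2 ^ L ≤ 2 ^ L * (N₀ + N₁) := by
    rw [Nat.mul_comm]; exact Nat.mul_le_mul_left _ (Nat.le_add_left N₁ N₀)
  have hex : ∃ θ : ℕ, N₁ * 2 ^ L ≤ θ * (N₀ + N₁) := ⟨2 ^ L, h2L⟩
  refine ⟨Nat.find hex, (Nat.find_le_iff hex _).2 ⟨2 ^ L, le_rfl, h2L⟩, Nat.find_spec hex, ?_, ?_⟩
  · rcases Nat.eq_zero_or_pos (Nat.find hex) with h0 | hpos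
    · rw [h0]; simp; omega
    · have hmin := Nat.find_min hex (m := Nat.find hex - 1) (by omega)
      push Not at hmin
      have : (Nat.find hex - 1) * (N₀ + N₁) + (N₀ + N₁) = Nat.find hex * (N₀ + N₁) := by
        rw [← Nat.succ_mul]; congr 1; omega
      omega
  · intro t
    constructor
    · intro ht
      by_contra hle
      push Not at hle
      have h1 : Nat.find hex * (N₀ + N₁) ≤ t * (N₀ + N₁) := Nat.mul_le_mul_right _ hle
      have h2 := Nat.find_spec hex
      omega
    · intro ht
      have hmin := Nat.find_min hex ht
      omega

/-- **The law of the biased coin.** For `S = N₀ + N₁ > 0` and a uniform `v ∈ {0,1}^L`: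
`Pr[choiceBit = b] ≥ N_b/S - 2^{-L}` (`N_true = N₁`, `N_false = N₀`). [folklore] -/
theorem choice_prob_ge (N₀ N₁ L : ℕ) (hS : 0 < N₀ + N₁) (b : Bool) :
    (cond b N₁ N₀ : ℝ) / (N₀ + N₁) - 1 / 2 ^ L ≤
      uniformProb L {v | choiceBit N₀ N₁ L (bitsToNat v) = b} := by
  obtain ⟨θ, hθ, hge, hlt, hiff⟩ := exists_threshold N₀ N₁ L hS
  have hS' : (0 : ℝ) < (N₀ : ℝ) + N₁ := by exact_mod_cast hS
  have h2L : (0 : ℝ) < 2 ^ L := by positivity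
  have htrue : cnt L {v | choiceBit N₀ N₁ L (bitsToNat v) = true} = θ := by
    rw [← cnt_val_lt hθ]
    exact cnt_congr fun v _ => by simp [choiceBit, hiff]
  have hfalse : cnt L {v | choiceBit N₀ N₁ L (bitsToNat v) = false} = 2 ^ L - θ := by
    have h := cnt_add_cnt_compl L {v | choiceBit N₀ N₁ L (bitsToNat v) = true}
    rw [htrue] at h
    have hc : ({v | choiceBit N₀ N₁ L (bitsToNat v) = true}ᶜ : Set (List Bool)) =
        {v | choiceBit N₀ N₁ L (bitsToNat v) = false} := by
      ext v; simp
    rw [hc] at h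
    omega
  rw [uniformProb_eq_cnt_div]
  cases b with
  | true =>
    rw [htrue]
    simp only [cond_true]
    have h1 : (N₁ : ℝ) * 2 ^ L ≤ θ * (N₀ + N₁) := by exact_mod_cast hge
    rw [div_sub_div _ _ hS'.ne' h2L.ne', div_le_div_iff₀ (mul_pos hS' h2L) h2L]
    nlinarith
  | false =>
    rw [hfalse]
    simp only [cond_false]
    have h1 : (θ : ℝ) * (N₀ + N₁) < N₁ * 2 ^ L + (N₀ + N₁) := by exact_mod_cast hlt
    have h2 : ((2 ^ L - θ : ℕ) : ℝ) = 2 ^ L - θ := by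
      rw [Nat.cast_sub hθ]; push_cast; ring
    rw [h2, div_sub_div _ _ hS'.ne' h2L.ne', div_le_div_iff₀ (mul_pos hS' h2L) h2L]
    nlinarith

/-! ### One round -/

/-- Accurate estimates give a good bias: if `N₀, N₁` are `(1+1/k)`-accurate for `c₀, c₁` and the
wanted side has `c_b ≥ 1`, then `N₀ + N₁ > 0` and `(c_b/(c₀+c₁))/(1+1/k)² ≤ N_b/(N₀+N₁)`. [folklore] -/
theorem bias_of_accurate {k c₀ c₁ N₀ N₁ : ℕ} (b : Bool) (hc : 0 < cond b c₁ c₀)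
    (hA₀ : IsApproxCount k c₀ N₀) (hA₁ : IsApproxCount k c₁ N₁) :
    0 < N₀ + N₁ ∧
      (cond b c₁ c₀ : ℝ) / (c₀ + c₁) / (1 + 1 / (k : ℝ)) ^ 2 ≤ (cond b N₁ N₀ : ℝ) / (N₀ + N₁) := by
  set g : ℝ := 1 + 1 / (k : ℝ) with hg
  have hg1 : 1 ≤ g := by
    have h0 : (0 : ℝ) ≤ 1 / (k : ℝ) := by positivity
    rw [hg]; linarith
  have hg0 : 0 < g := by linarith
  -- the wanted side
  have hNb : (cond b c₁ c₀ : ℝ) / g ≤ (cond b N₁ N₀ : ℝ) := by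
    cases b
    · exact hA₀.1
    · exact hA₁.1
  have hcb : (1 : ℝ) ≤ (cond b c₁ c₀ : ℝ) := by
    cases b <;> simp only [cond_true, cond_false] at hc ⊢ <;> exact_mod_cast hc
  have hNbpos : (0 : ℝ) < (cond b N₁ N₀ : ℝ) := lt_of_lt_of_le (div_pos (by linarith) hg0) hNb
  have hSpos : 0 < N₀ + N₁ := by
    have : (0 : ℝ) < (N₀ : ℝ) + N₁ := by
      cases b
      · simp only [cond_false] at hNbpos; have := (Nat.cast_nonneg (α := ℝ) N₁); linarith
      · simp only [cond_true] at hNbpos; have := (Nat.cast_nonneg (α := ℝ) N₀); linarith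
    exact_mod_cast this
  refine ⟨hSpos, ?_⟩
  have hS : ((N₀ : ℝ) + N₁) ≤ g * (c₀ + c₁) := by
    have h0 := hA₀.2; have h1 := hA₁.2
    rw [← hg] at h0 h1
    linarith
  have hSpos' : (0 : ℝ) < (N₀ : ℝ) + N₁ := by exact_mod_cast hSpos
  have hcpos : (0 : ℝ) < (c₀ : ℝ) + c₁ := by
    cases b
    · simp only [cond_false] at hcb; have := (Nat.cast_nonneg (α := ℝ) c₁); linarith
    · simp only [cond_true] at hcb; have := (Nat.cast_nonneg (α := ℝ) c₀); linarith
  rw [div_div, div_le_div_iff₀ (by positivity) hSpos']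
  have hNb' : (cond b c₁ c₀ : ℝ) ≤ g * (cond b N₁ N₀ : ℝ) := by
    rwa [div_le_iff₀ hg0, mul_comm] at hNb
  calc (cond b c₁ c₀ : ℝ) * ((N₀ : ℝ) + N₁)
      ≤ (g * (cond b N₁ N₀ : ℝ)) * (g * (c₀ + c₁)) :=
        mul_le_mul hNb' hS hSpos'.le (by positivity)
    _ = (cond b N₁ N₀ : ℝ) * ((c₀ + c₁) * g ^ 2) := by ring

/-- **One round produces the wanted bit with probability at least
`a₀ · a₁ · (p_b/(1+1/k)² - 2^{-L})`**, where `a_i ≤ Pr[A_i]`, `A_i` the event that the estimate of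
the extension count `c_i` is `(1+1/k)`-accurate, `p_b = c_b/(c₀+c₁)`, and the wanted side has
`c_b ≥ 1` (coins: `blk = u₀ ++ u₁ ++ v`, `|u₀| = |u₁| = U`, `|v| = L`; two fibrewise lower bounds).
[cite: JerrumValiantVazirani1986, §3] -/
theorem step_prob_ge (est : List Bool → Bool → List Bool → ℕ) (U L k : ℕ) (w : List Bool)
    (c₀ c₁ : ℕ) (b : Bool) (hc : 0 < cond b c₁ c₀) {a₀ a₁ : ℝ} (ha₀ : 0 ≤ a₀) (ha₁ : 0 ≤ a₁)
    (h₀ : a₀ ≤ uniformProb U {u | IsApproxCount k c₀ (est w false u)})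
    (h₁ : a₁ ≤ uniformProb U {u | IsApproxCount k c₁ (est w true u)}) :
    a₀ * (a₁ * ((cond b c₁ c₀ : ℝ) / (c₀ + c₁) / (1 + 1 / (k : ℝ)) ^ 2 - 1 / 2 ^ L)) ≤
      uniformProb (U + (U + L)) {blk | stepJVV est U L w blk = w ++ [b]} := by
  set B : ℝ := (cond b c₁ c₀ : ℝ) / (c₀ + c₁) / (1 + 1 / (k : ℝ)) ^ 2 - 1 / 2 ^ L with hB
  rcases le_or_gt B 0 with hB0 | hB0
  · exact le_trans (mul_nonpos_of_nonneg_of_nonpos ha₀ (mul_nonpos_of_nonneg_of_nonpos ha₁ hB0))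
      (uniformProb_nonneg _ _)
  -- fibres over `u₀`
  have hfib₀ : ∀ u₀ : List Bool, u₀.length = U → u₀ ∈ {u | IsApproxCount k c₀ (est w false u)} →
      a₁ * B ≤ uniformProb (U + L) {rest | u₀ ++ rest ∈ {blk | stepJVV est U L w blk = w ++ [b]}} := by
    intro u₀ hu₀ hA₀
    have hset : {rest : List Bool | u₀ ++ rest ∈ {blk | stepJVV est U L w blk = w ++ [b]}} =
        {rest | choiceBit (est w false u₀) (est w true (rest.take U)) L
          (bitsToNat ((rest.drop U).take L)) = b} := by
      ext rest
      simp only [Set.mem_setOf_eq, stepJVV]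
      rw [List.append_cancel_left_eq, List.cons.injEq]
      have h1 : (u₀ ++ rest).take U = u₀ := by rw [List.take_append_of_le_length hu₀.ge, ← hu₀, List.take_length]
      have h2 : (u₀ ++ rest).drop U = rest := by rw [← hu₀, List.drop_left]
      have h3 : (u₀ ++ rest).drop (2 * U) = rest.drop U := by
        rw [two_mul, ← List.drop_drop, ← hu₀, List.drop_left]
      rw [h1, h2, h3]
      simp
    rw [hset]
    -- fibres over `u₁`
    have hfib₁ : ∀ u₁ : List Bool, u₁.length = U → u₁ ∈ {u | IsApproxCount k c₁ (est w true u)} →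
        B ≤ uniformProb L {v | u₁ ++ v ∈ {rest : List Bool | choiceBit (est w false u₀)
          (est w true (rest.take U)) L (bitsToNat ((rest.drop U).take L)) = b}} := by
      intro u₁ hu₁ hA₁
      obtain ⟨hS, hbias⟩ := bias_of_accurate b hc hA₀ hA₁
      have hset' : uniformProb L {v | u₁ ++ v ∈ {rest : List Bool | choiceBit (est w false u₀)
          (est w true (rest.take U)) L (bitsToNat ((rest.drop U).take L)) = b}} =
          uniformProb L {v | choiceBit (est w false u₀) (est w true u₁) L (bitsToNat v) = b} := by
        rw [uniformProb_eq_cnt_div, uniformProb_eq_cnt_div]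
        congr 1
        exact_mod_cast cnt_congr fun v hv => by
          simp only [Set.mem_setOf_eq]
          rw [List.take_append_of_le_length hu₁.ge, ← hu₁, List.take_length, List.drop_left,
            List.take_of_length_le hv.le]
      rw [hset']
      exact le_trans (by rw [hB]; linarith) (choice_prob_ge _ _ L hS b)
    calc a₁ * B ≤ uniformProb U {u | IsApproxCount k c₁ (est w true u)} * B :=
          mul_le_mul_of_nonneg_right h₁ hB0.le
      _ ≤ _ := le_uniformProb_add_of_fibre hfib₁
  calc a₀ * (a₁ * B) ≤ uniformProb U {u | IsApproxCount k c₀ (est w false u)} * (a₁ * B) :=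
        mul_le_mul_of_nonneg_right h₀ (mul_nonneg ha₁ hB0.le)
    _ ≤ _ := le_uniformProb_add_of_fibre hfib₀


end Summit.PneNP.PneNP.Theorems.SatBridgeJVV
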